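/-
Copyright (c) 2026. All rights reserved.
Released under Apache 2.0 license as described in the file LICENSE.
Authors: abc-iut cell, fact-proving seat abc-iut-f-102 (block F, tranche 102, gen 2).
-/
import Literature.AnabelianGeometry.AbsoluteAnabelian.LogFrobeniusObservablesMoves
import Literature.AnabelianGeometry.AbsoluteAnabelian.LogFrobeniusShiftActionNecessity
import Literature.AnabelianGeometry.AbsoluteAnabelian.LogFrobeniusShiftActionPinning
import HarnessLib

/-!
# [AbsTopIII] Corollary 5.5 (v): the `ℤ`-action clause ⟺ realisability of (i)/(iii) in one family (THEOREM A: F-0157 ⟺ `∃ K`, F-0159)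

S. Mochizuki, *Topics in absolute anabelian geometry III: global reconstruction algorithms*,
J. Math. Sci. Univ. Tokyo 22 (2015) 939–1156 [MochizukiAbsTopIII2015]; locators `p.N` = pages of the
author's manuscript (`paper:url-5493eb38cbb7`): §0 p. 26, Def 3.5 (ii), (iii) pp. 75–76, Cor 5.5 (i) p. 130, (iii) p. 131,
(v) pp. 131–132; proof of (v) p. 133: "The remainder of assertion (v) is immediate from the definitions and
constructions".

PROOF-ONLY companion closing THEOREM A of this seat (abc-iut-f-102) over `LogFrobeniusRigidity.lean` (abc-iut-L4-t3:
`Cor55ShiftAction` = FACT-LIST F-0157, `RealisesCor55Families` = F-0159, `Cor55Rigidity` = F-0156), with the toolkit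
`LogFrobeniusShiftInvariantPart.lean` (the shift-invariant part `K^ℤ`), `LogFrobeniusShiftActionPostLogPair.lean` (the
post-log pair of `S_log⊞_v` is shift-invariant) and `LogFrobeniusShiftActionPinning.lean` (PINNING).  For EVERY setting `L`:

* `E_of_isCoreOnIn`: a core with core vertex `x` embedded in `K` puts EVERY co-verticial pair of paths of `Γ⃗_{D•⊢}` into `x`
  from the rows below into `E_K` (paths of `Γ⃗_{D•⊢}` into `x` lift to the extended sub-diagram: `exists_lift_obs`);
* `isCoreOnIn_shiftInvariantPart`: hence (PINNING) the SAME core structure is embedded in the shift-invariant part `K^ℤ`,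
  provided `K` carries one observable `S_log⊞_{v₀}`;
* `exists_isLogObservablePlus_shiftInvariantPart`: every observable `S_log⊞_v` embedded in `K` restricts (along the pairs
  whose images are shift-invariant — a saturated set containing the generators, whose homotopies `ι⊞_{v,ε}` are pinned) to
  an observable embedded in `K^ℤ`;
* `realisesCor55Families_shiftInvariantPart`: **if `K` realises the cores of Cor 5.5 (i) and the observables of (iii), so
  does its shift-invariant part `K^ℤ`**; whence
* **`cor55ShiftAction_iff_exists_realisesCor55Families` (THEOREM A): `Cor55ShiftAction L ↔ ∃ K, RealisesCor55Families K`** —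
  the `ℤ`-action clause (3) of the typed Cor 5.5 (v) (F-0157: ONE family realising (i)/(iii) COMPATIBLY WITH EVERY SHIFT,
  abc-iut-w5-d112's `cor55ShiftAction_iff`) carries NO condition beyond the realisability of (i)/(iii) in one family (the
  `∃`-instance of F-0159); and `cor55Rigidity_iff_isIdRigid_and_exists` (F-0156).

HONEST LABEL: a theorem about the TYPED statements over an arbitrary interface `L`; it makes print's "immediate from the
definitions" (p. 133) literal at the interface — compatibility with the shifts is automatic once (i) and (iii) are realised in
one family — and says nothing about WHICH settings realise them (see this seat's `LogFrobeniusShiftActionIotaIso.lean` for the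
necessary condition "every `ι⊞_{v,ε}` invertible over `ℰ•`", abc-iut-w4-d095's diagonal setting for an instance).  Refereed
pre-IUT material; nothing here bears on [IUTchIII] Cor. 3.12; no side taken; typed ≠ proved.
-/

set_option autoImplicit false

universe v v' u w w'

open CategoryTheory Quiver

namespace Literature.AnabelianGeometry.AbsoluteAnabelian

/-! ## §0: intersections and preimages of saturated sets -/

section Saturated

variable {V : Type w} [Quiver.{v} V] {V' : Type w'} [Quiver.{v'} V']

/-- The intersection of two saturated sets of co-verticial pairs is saturated (§0 (a)–(e) clause by clause).
[cite: MochizukiAbsTopIII2015, Section 0 p.26] -/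
theorem IsSaturated.inter {E₁ E₂ : ∀ ⦃a b : V⦄, Path a b → Path a b → Prop} (h₁ : IsSaturated E₁)
    (h₂ : IsSaturated E₂) : IsSaturated (fun ⦃a b : V⦄ (p q : Path a b) => E₁ p q ∧ E₂ p q) where
  refl_left _ _ _ _ h := ⟨h₁.refl_left h.1, h₂.refl_left h.2⟩
  refl_right _ _ _ _ h := ⟨h₁.refl_right h.1, h₂.refl_right h.2⟩
  trans _ _ _ _ _ h h' := ⟨h₁.trans h.1 h'.1, h₂.trans h.2 h'.2⟩
  precomp _ _ _ _ _ h r := ⟨h₁.precomp h.1 r, h₂.precomp h.2 r⟩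
  postcomp _ _ _ _ _ h r := ⟨h₁.postcomp h.1 r, h₂.postcomp h.2 r⟩

/-- The preimage of a saturated set under a morphism of oriented graphs (acting on paths) is saturated.
[cite: MochizukiAbsTopIII2015, Section 0 p.26] -/
theorem IsSaturated.comap (F : V' ⥤q V) {E : ∀ ⦃a b : V⦄, Path a b → Path a b → Prop} (hE : IsSaturated E) :
    IsSaturated (fun ⦃a b : V'⦄ (p q : Path a b) => E (F.mapPath p) (F.mapPath q)) where
  refl_left _ _ _ _ h := hE.refl_left h
  refl_right _ _ _ _ h := hE.refl_right h
  trans _ _ _ _ _ h h' := hE.trans h h'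
  precomp _ _ _ _ _ h r := by
    simp only [Prefunctor.mapPath_comp]
    exact hE.precomp h _
  postcomp _ _ _ _ _ h r := by
    simp only [Prefunctor.mapPath_comp]
    exact hE.postcomp h _

end Saturated

/-! ## Paths of `Γ⃗_{D•⊢}` into a core vertex lift to the extended sub-diagram -/

namespace DVertex

variable {Vmod : Type u} {isArc : Vmod → Bool}

/-- Along an arrow of `Γ⃗_{D•⊢}` rows do not decrease and holomorphy is reflected: `D•_{≤r}` is closed under taking
sources. [cite: MochizukiAbsTopIII2015, Cor 5.5 p. 130] -/
theorem inFirstRows_of_hom {r : ℕ} {d c : DVertex Vmod isArc} (e : d ⟶ c) (hc : c.InFirstRows r) : d.InFirstRows r := by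
  obtain ⟨hh, hr⟩ := hc
  cases e <;> simp only [InFirstRows, IsHolomorphic, row] at hh hr ⊢ <;> exact ⟨trivial, by omega⟩

end DVertex

namespace LogFrobeniusSetting

open DiagramOfCategories

variable {Vmod : Type u} {isArc : Vmod → Bool} {L : LogFrobeniusSetting Vmod isArc}

/-- A path of `Γ⃗_{D•⊢}` into a vertex of `D_{≤P}` lifts to a path of base vertices of `Γ⃗_{D_{≤P} ∪ {x}}`, provided `P` is
closed under taking sources of arrows. [cite: MochizukiAbsTopIII2015, Cor 5.5 (i) p. 130] -/
theorem exists_lift_base (P : DVertex Vmod isArc → Prop) (x : DVertex Vmod isArc)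
    (hcl : ∀ {d c : DVertex Vmod isArc} (_ : d ⟶ c), P c → P d) {a c : DVertex Vmod isArc} (p : Path a c)
    (hc : P c) : ∃ (ha : P a) (p₁ : Path ((obsShape P x).base ⟨a, ha⟩) ((obsShape P x).base ⟨c, hc⟩)),
      (embExt P x).mapPath p₁ = p := by
  induction p with
  | nil => exact ⟨hc, Path.nil, rfl⟩
  | cons p e ih =>
    obtain ⟨ha, p₁, hp₁⟩ := ih (hcl e hc)
    exact ⟨ha, p₁.cons (show (obsShape P x).base ⟨_, hcl e hc⟩ ⟶ (obsShape P x).base ⟨_, hc⟩ from e),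
      by rw [Prefunctor.mapPath_cons, hp₁]; rfl⟩

/-- A path of `Γ⃗_{D•⊢}` into `x` from a vertex of `D_{≤P}` lifts to a path into the observation vertex of
`Γ⃗_{D_{≤P} ∪ {x}}` (`x ∉ D_{≤P}`, arrows into `x` come from `D_{≤P}`, `P` closed under sources).
[cite: MochizukiAbsTopIII2015, Cor 5.5 (i) p. 130] -/
theorem exists_lift_obs {P : DVertex Vmod isArc → Prop} {x : DVertex Vmod isArc} (hxP : ¬ P x)
    (hcl : ∀ {d c : DVertex Vmod isArc} (_ : d ⟶ c), P c → P d) (hedge : ∀ {c : DVertex Vmod isArc} (_ : c ⟶ x), P c)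
    {a : DVertex Vmod isArc} (ha : P a) (p : Path a x) :
    ∃ p' : Path ((obsShape P x).base ⟨a, ha⟩) (obsShape P x).obs, (embExt P x).mapPath p' = p := by
  cases p with
  | nil => exact (hxP ha).elim
  | cons p e =>
    obtain ⟨_, p₁, hp₁⟩ := exists_lift_base P x hcl p (hedge e)
    exact ⟨p₁.cons (show (obsShape P x).base ⟨_, hedge e⟩ ⟶ (obsShape P x).obs from e),
      by rw [Prefunctor.mapPath_cons, hp₁]; rfl⟩

/-- **A core embedded in `K` puts every pair of paths into its core vertex into `E_K`**: for a core structure of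
`D_{≤P} ∪ {x}` on `D_{≤P}` embedded in `K` (`IsCoreOnIn`), every co-verticial pair of paths of `Γ⃗_{D•⊢}` from a vertex of
`D_{≤P}` to `x` is a boundary pair of `K` (Def 3.5 (iii): all co-verticial pairs into the core vertex are boundary pairs;
both paths lift). [cite: MochizukiAbsTopIII2015, Definition 3.5 (iii) pp.75–76] -/
theorem E_of_isCoreOnIn {K : L.diagram.HomotopyFamily} {P : DVertex Vmod isArc → Prop} {x : DVertex Vmod isArc}
    (h : L.IsCoreOnIn K P x) (hxP : ¬ P x) (hcl : ∀ {d c : DVertex Vmod isArc} (_ : d ⟶ c), P c → P d)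
    (hedge : ∀ {c : DVertex Vmod isArc} (_ : c ⟶ x), P c) {a : DVertex Vmod isArc} (ha : P a) (p q : Path a x) :
    K.E p q := by
  obtain ⟨H, hH, hcore, hcomp⟩ := h
  obtain ⟨p', rfl⟩ := exists_lift_obs hxP hcl hedge ha p
  obtain ⟨q', rfl⟩ := exists_lift_obs hxP hcl hedge ha q
  obtain ⟨k, -⟩ := hcomp p' q' (hcore.boundary_all p' q')
  exact k

/-! ## Cores embedded in `K` stay embedded in `K^ℤ` -/

/-- Boundary pairs of `K` into a vertex `x` outside the first two rows are shift-invariant pairs, whatever their source,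
under the hypotheses of PINNING (`shiftInvariantE_of_row1`): sources `𝒳_⋎` by pinning, `□` and the higher rows being
shift-fixed. [cite: MochizukiAbsTopIII2015, Cor 5.5 (v) p. 133] -/
theorem shiftInvariantE_of_mem_into {K : L.diagram.HomotopyFamily} {x : DVertex Vmod isArc}
    (hx : ∀ k : ℤ, x.shift k = x) (hxc : x ≠ .core)
    (hrow : ∀ (m : ℤ) (P Q : Path (DVertex.row1 m : DVertex Vmod isArc) x), K.E P Q)
    (hcore : ∀ P Q : Path (DVertex.core : DVertex Vmod isArc) x, K.E P Q) {v₀ : Vmod}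
    (t : Path (DVertex.nplus v₀ : DVertex Vmod isArc) x)
    (ht : ∀ (v : Vmod) (q : Path (DVertex.nplus v : DVertex Vmod isArc) x), t.length ≤ q.length)
    (hobs : ∃ H : (L.logDiagramPlus v₀).HomotopyFamily, L.IsLogObservablePlus v₀ H ∧ L.CompatibleIn K H)
    {a : DVertex Vmod isArc} (p q : Path a x) (h : K.E p q) : L.ShiftInvariantE K p q := by
  cases a with
  | row1 m => exact shiftInvariantE_of_row1 hx hrow hcore hxc t ht hobs m p q
  | _ => exact shiftInvariantE_of_source_fixed K (fun _ => rfl) h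

/-- **A core of Cor 5.5 (i) embedded in `K` is embedded in the shift-invariant part `K^ℤ`** (same core structure), for a
core vertex `x` outside the first two rows reached from the observable `S_log⊞_{v₀}` carried by `K` along a shortest tail `t`:
every boundary pair of the core maps to a pair of paths into `x`, all of which are boundary pairs of `K`
(`E_of_isCoreOnIn`), hence shift-invariant (PINNING). [cite: MochizukiAbsTopIII2015, Cor 5.5 (v) p. 133] -/
theorem isCoreOnIn_shiftInvariantPart {K : L.diagram.HomotopyFamily} {r : ℕ} {x : DVertex Vmod isArc}
    (hx : ∀ k : ℤ, x.shift k = x) (hxc : x ≠ .core) (hxP : ¬ x.InFirstRows r)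
    (hr : (DVertex.core : DVertex Vmod isArc).InFirstRows r) (hedge : ∀ {c : DVertex Vmod isArc} (_ : c ⟶ x), c.InFirstRows r)
    {v₀ : Vmod} (t : Path (DVertex.nplus v₀ : DVertex Vmod isArc) x)
    (ht : ∀ (v : Vmod) (q : Path (DVertex.nplus v : DVertex Vmod isArc) x), t.length ≤ q.length)
    (hobs : ∃ H : (L.logDiagramPlus v₀).HomotopyFamily, L.IsLogObservablePlus v₀ H ∧ L.CompatibleIn K H)
    (h : L.IsCoreOnIn K (DVertex.InFirstRows r) x) : L.IsCoreOnIn (L.shiftInvariantPart K) (DVertex.InFirstRows r) x := by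
  have hrow : ∀ (m : ℤ) (P Q : Path (DVertex.row1 m : DVertex Vmod isArc) x), K.E P Q := fun m =>
    L.E_of_isCoreOnIn h hxP DVertex.inFirstRows_of_hom hedge ⟨trivial, le_trans (Nat.le_succ 1) hr.2⟩
  have hcore : ∀ P Q : Path (DVertex.core : DVertex Vmod isArc) x, K.E P Q :=
    L.E_of_isCoreOnIn h hxP DVertex.inFirstRows_of_hom hedge hr
  obtain ⟨H, hH, hc, hcomp⟩ := h
  refine ⟨H, hH, hc, compatibleIn_shiftInvariantPart hcomp fun a b p q hpq => ?_⟩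
  obtain rfl := hH hpq
  obtain ⟨k, -⟩ := hcomp p q hpq
  exact shiftInvariantE_of_mem_into hx hxc hrow hcore t ht hobs _ _ k

/-! ## Observables embedded in `K` restrict to observables embedded in `K^ℤ` -/

/-- **An observable `S_log⊞_v` embedded in `K` restricts to one embedded in `K^ℤ`**: restrict its family to the boundary pairs
whose images are shift-invariant pairs of `K` — a saturated set (§0) containing the generating pairs of Cor 5.5 (iii),
whose homotopies are pinned to the `ι⊞_{v,ε}` (pairs out of `□` are shift-fixed; the post-log pairs by
`shiftInvariantE_postLogPair`; abc-iut-f-101's `LogVertex.eq_postLog_of_isPostLog`). [cite: MochizukiAbsTopIII2015, Cor 5.5 (iii) p. 131] -/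
theorem exists_isLogObservablePlus_shiftInvariantPart {K : L.diagram.HomotopyFamily} (v : Vmod)
    (h : ∃ H : (L.logDiagramPlus v).HomotopyFamily, L.IsLogObservablePlus v H ∧ L.CompatibleIn K H) :
    ∃ H : (L.logDiagramPlus v).HomotopyFamily, L.IsLogObservablePlus v H ∧ L.CompatibleIn (L.shiftInvariantPart K) H := by
  obtain ⟨H, hH, hcomp⟩ := h
  let E' : ∀ ⦃a b : (logShapePlus (isArc := isArc) v).Vertex⦄, Path a b → Path a b → Prop := fun a b p q =>
    H.E p q ∧ L.ShiftInvariantE K ((embExt (DVertex.InFirstRows 2) (.nplus v)).mapPath p)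
      ((embExt (DVertex.InFirstRows 2) (.nplus v)).mapPath q)
  have hE' : IsSaturated E' := H.isSaturated.inter ((shiftInvariantE_isSaturated K).comap _)
  refine ⟨H.restrictBoundary E' hE' (fun _ _ _ _ h => h.1), ⟨fun a b p q h => hH.1 h.1, ?_, ?_⟩, ?_⟩
  · -- pre-log generating pairs `([λ⊞_{ν₁}], [λ⊞_{ν₂}])`: out of `□`, shift-fixed
    intro ν₁ ν₂ ε h₁ h₂
    obtain ⟨hmem, hι⟩ := hH.2.1 ν₁ ν₂ ε h₁ h₂
    obtain ⟨k, -⟩ := hcomp _ _ hmem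
    exact ⟨⟨hmem, shiftInvariantE_of_source_fixed K (fun _ => rfl) k⟩, hι⟩
  · -- post-log generating pairs: pinned (`shiftInvariantE_postLogPair`)
    intro ν₁ ν₂ ε h₁ h₂ hsl n
    obtain rfl := LogVertex.eq_postLog_of_isPostLog _ h₁
    obtain ⟨hmem, hι⟩ := hH.2.2 _ ν₂ ε h₁ h₂ hsl n
    exact ⟨⟨hmem, L.shiftInvariantE_postLogPair v ⟨H, hH, hcomp⟩ ε h₂ n⟩, hι⟩
  · exact compatibleIn_shiftInvariantPart (fun a b p q h => hcomp p q h.1) fun a b p q h => h.2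

/-! ## Shortest tails from `𝒩⊞_v` to the three core vertices -/

/-- Every path `𝒩⊞_v → ℰ•` has length at least `2`. [cite: MochizukiAbsTopIII2015, Cor 5.5 p. 129] -/
theorem two_le_length_path_nplus_e5 (v : Vmod) (q : Path (DVertex.nplus v : DVertex Vmod isArc) .e5) :
    2 ≤ q.length := by
  cases q with
  | cons q e =>
    cases e with
    | toE v' =>
      cases q with
      | cons q' e' => simp only [Path.length_cons]; omega

/-- Every path `𝒩⊞_v → An•[𝒳]` has length at least `3`. [cite: MochizukiAbsTopIII2015, Cor 5.5 p. 129] -/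
theorem three_le_length_path_nplus_an (v : Vmod) (q : Path (DVertex.nplus v : DVertex Vmod isArc) .an) :
    3 ≤ q.length := by
  cases q with
  | cons q e =>
    cases e with
    | κAn => have := two_le_length_path_nplus_e5 v q; simp only [Path.length_cons]; omega

/-- Every path `𝒩⊞_v → ℰ•` (row 7) has length at least `4`. [cite: MochizukiAbsTopIII2015, Cor 5.5 p. 129] -/
theorem four_le_length_path_nplus_e7 (v : Vmod) (q : Path (DVertex.nplus v : DVertex Vmod isArc) .e7) :
    4 ≤ q.length := by
  cases q with
  | cons q e =>
    cases e with
    | anToE => have := three_le_length_path_nplus_an v q; simp only [Path.length_cons]; omega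

/-! ## THEOREM A -/

/-- **If `K` realises the cores of Cor 5.5 (i) and the observables of (iii), so does its shift-invariant part `K^ℤ`.**
(`V(F_mod) ≠ ∅` by `nonempty_of_realisesCor55Families`; the cores at `ℰ•`, `An•[𝒳]`, `ℰ•` stay embedded by PINNING along
the tails `𝒩⊞_{v₀} → 𝒩_{v₀} → ℰ• (→ An•[𝒳] → ℰ•)`; the observables restrict.)
[cite: MochizukiAbsTopIII2015, Cor 5.5 (v) p. 133] -/
theorem realisesCor55Families_shiftInvariantPart {K : L.diagram.HomotopyFamily} (hK : L.RealisesCor55Families K) :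
    L.RealisesCor55Families (L.shiftInvariantPart K) := by
  obtain ⟨v₀⟩ := L.nonempty_of_realisesCor55Families hK
  have hobs := hK.2.2.2 v₀
  let t₅ : Path (DVertex.nplus v₀ : DVertex Vmod isArc) .e5 :=
    (Path.nil.cons (DEdge.forget v₀ : (DVertex.nplus v₀ : DVertex Vmod isArc) ⟶ .nv v₀)).cons
      (DEdge.toE v₀ : (DVertex.nv v₀ : DVertex Vmod isArc) ⟶ .e5)
  let t₆ : Path (DVertex.nplus v₀ : DVertex Vmod isArc) .an :=
    t₅.cons (DEdge.κAn : (DVertex.e5 : DVertex Vmod isArc) ⟶ .an)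
  let t₇ : Path (DVertex.nplus v₀ : DVertex Vmod isArc) .e7 :=
    t₆.cons (DEdge.anToE : (DVertex.an : DVertex Vmod isArc) ⟶ .e7)
  refine ⟨?_, ?_, ?_, fun v => L.exists_isLogObservablePlus_shiftInvariantPart v (hK.2.2.2 v)⟩
  · exact L.isCoreOnIn_shiftInvariantPart (fun _ => rfl) (by intro h; cases h)
      (by simp [DVertex.InFirstRows, DVertex.row]) ⟨trivial, Nat.le_of_ble_eq_true rfl⟩
      (fun e => by cases e; exact ⟨trivial, Nat.le_of_ble_eq_true rfl⟩) t₅ (fun v q => two_le_length_path_nplus_e5 v q)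
      hobs hK.1
  · exact L.isCoreOnIn_shiftInvariantPart (fun _ => rfl) (by intro h; cases h)
      (by simp [DVertex.InFirstRows, DVertex.row]) ⟨trivial, Nat.le_of_ble_eq_true rfl⟩
      (fun e => by cases e; exact ⟨trivial, Nat.le_of_ble_eq_true rfl⟩) t₆ (fun v q => three_le_length_path_nplus_an v q)
      hobs hK.2.1
  · exact L.isCoreOnIn_shiftInvariantPart (fun _ => rfl) (by intro h; cases h)
      (by simp [DVertex.InFirstRows, DVertex.row]) ⟨trivial, Nat.le_of_ble_eq_true rfl⟩
      (fun e => by cases e; exact ⟨trivial, Nat.le_of_ble_eq_true rfl⟩) t₇ (fun v q => four_le_length_path_nplus_e7 v q)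
      hobs hK.2.2.1

variable (L)

/-- **THEOREM A — Cor 5.5 (v), third clause (F-0157) ⟺ ONE family realises Cor 5.5 (i)/(iii) (the `∃`-instance of F-0159).**
`Cor55ShiftAction L` asks for a family realising the cores of (i) and the observables of (iii) COMPATIBLY WITH EVERY SHIFT
`⋎ ↦ ⋎ + k` (abc-iut-w5-d112's `cor55ShiftAction_iff`; the equivalence and group-law clauses hold for every setting); the
compatibility is AUTOMATIC: the shift-invariant part of any realising family realises again (`realisesCor55Families_
shiftInvariantPart`) and is compatible with every shift (`cor55ShiftAction_of_realises_shiftInvariantPart`).  This is print's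
"immediate from the definitions and constructions" (p. 133) at the level of the typed interface.
[cite: MochizukiAbsTopIII2015, Cor 5.5 (v) pp. 131–133] -/
theorem cor55ShiftAction_iff_exists_realisesCor55Families :
    L.Cor55ShiftAction ↔ ∃ K : L.diagram.HomotopyFamily, L.RealisesCor55Families K := by
  refine ⟨fun h => ?_, fun ⟨K, hK⟩ =>
    cor55ShiftAction_of_realises_shiftInvariantPart K (L.realisesCor55Families_shiftInvariantPart hK)⟩
  obtain ⟨K, hK, -⟩ := L.cor55ShiftAction_iff.mp h
  exact ⟨K, hK⟩

/-- **Cor 5.5 (v) as one node (F-0156)** ⟺ `𝒳 = Th•_T[Z]` is id-rigid (abc-iut-w5-d112's `cor55CoreRigid_iff`) and one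
family of homotopies on `D•⊢` realises Cor 5.5 (i)/(iii). [cite: MochizukiAbsTopIII2015, Cor 5.5 (v) pp. 131–133] -/
theorem cor55Rigidity_iff_isIdRigid_and_exists :
    L.Cor55Rigidity ↔ IsIdRigid L.X ∧ ∃ K : L.diagram.HomotopyFamily, L.RealisesCor55Families K :=
  and_congr L.cor55CoreRigid_iff L.cor55ShiftAction_iff_exists_realisesCor55Families

/-- The shift-compatibility clause adds nothing to realisability: a setting realising (i)/(iii) in some family realises
them in a family compatible (Def 3.5 (v)) with every shift. [cite: MochizukiAbsTopIII2015, Cor 5.5 (v) p. 133] -/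
theorem exists_realises_compatible_of_exists_realises (h : ∃ K : L.diagram.HomotopyFamily, L.RealisesCor55Families K) :
    ∃ K : L.diagram.HomotopyFamily, L.RealisesCor55Families K ∧
      ∀ k : ℤ, Nonempty ((L.shiftOneMorphism k).CompatibleWith K K) :=
  L.cor55ShiftAction_iff.mp (L.cor55ShiftAction_iff_exists_realisesCor55Families.mpr h)

end LogFrobeniusSetting

end Literature.AnabelianGeometry.AbsoluteAnabelian
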